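import Literature.AlgebraicGeometry.HodgeTheory.CorrespondenceCupProductIdentities
import Literature.AlgebraicGeometry.HodgeTheory.SupportedClassesKunneth
import Literature.AlgebraicGeometry.HodgeTheory.GysinProjectionNonvanishing
import Literature.AlgebraicGeometry.HodgeTheory.SupportedClassesPurity
import Literature.AlgebraicGeometry.HodgeTheory.AlgebraicClassesExteriorProduct
import Literature.AlgebraicGeometry.HodgeTheory.TopDegreeClasses
import HarnessLib

/-!
# `p₁₂^* γ ∪ p₂₃^* γ₁` for surfaces: the excess case of a common curve, from the moving of ONE prime divisor

Family `hodge`, layer `Literature/AlgebraicGeometry/HodgeTheory`. Second file (after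
`CorrespondenceCupProductIdentities`) towards the multiplicativity `N² ∪ N² ⊆ N⁴` on the sixfold
`A ⊗ (B ⊗ C)` for the PULLED-BACK pairs `p₁₂^* γ`, `p₂₃^* γ₁` (`γ ∈ N²H⁴((A ⊗ B)(ℂ))`,
`γ₁ ∈ N²H⁴((B ⊗ C)(ℂ))`, `A, B, C` smooth projective surfaces) — the instance of C. Voisin,
*Hodge Theory II*, Prop. 9.20 that the composition of correspondences between surfaces consumes
(W. Fulton, *Intersection Theory*, Def. 16.1.1; N. Buskin, J. reine angew. Math. 755 (2019),
Lemma 6.3). This file treats the only configuration of supports in which `p₁₂⁻¹Γ ∩ p₂₃⁻¹Γ'` has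
excess dimension away from the "vertical" supports: `Γ ⊆ A × D` and `Γ' ⊆ D × C` over a COMMON
irreducible curve `D ⊆ B` (Fulton §6.3, excess intersection; here replaced by the relative
Künneth formula):

* `exists_cross_add_of_restrictCompl_snd_preimage_eq_zero` /
  `exists_cross_add_of_restrictCompl_fst_preimage_eq_zero` — a class `γ ∈ H⁴((A ⊗ B)(ℂ))` dying off
  `pr_B⁻¹ D` is `pr_A^* α ∪ pr_B^* τ + r` with `τ` the purity generator of the classes supported on
  `D` and `r` a combination of cross products whose `B`-factor has degree `≥ 3` (Künneth with
  supports, `SupportedClassesKunneth`; semipurity and purity, `SupportedClassesSemipurity` /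
  `SupportedClassesPurity`); symmetrically on `B ⊗ C`;
* `fst_coeff_mem_algebraicClasses` / `snd_coeff_mem_algebraicClasses` — **the Künneth coefficient
  `α` (resp. `θ`) is algebraic** as soon as some class `ψ ∈ H²(B(ℂ))` dying off a closed `T ⊆ B`
  with `Γ ∩ pr_B⁻¹T` of codimension `≥ 3` has `τ ∪ ψ ≠ 0`: then
  `γ ∪ pr_B^* ψ = pr_A^* α ∪ pr_B^*(τ ∪ ψ)` is supported in codimension `3` (cup product with
  supports), so `(pr_A)_*(γ ∪ pr_B^* ψ) = c • α`, `c ≠ 0`, is algebraic (push-forward of algebraic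
  classes; `GysinProjectionNonvanishing`);
* `cup_p12_p23_mem_algebraicClasses_of_common_curve` — **the excess case**: if both supports lie
  over `D` and, at the generic point `b` of `D`, the prime divisor `D` MOVES (`ker_D ≤ ℂ ψ + ker_{W'}`
  with `ψ` dying off `T`, `b ∉ T ∪ W'` — the pointwise hypothesis of
  `AlgebraicClassesCupDivisor.cupProduct_mem_algebraicClasses_one_of_forall_primeDivisor`, the
  Lelong–Poincaré input of the divisor case), then `p₁₂^* γ ∪ p₂₃^* γ₁ ∈ N⁴H⁸`: by
  `CorrespondenceCupProductIdentities` the product is `pr_A^* α ∪ pr_{B⊗C}^*(pr_B^*(τ ∪ τ) ∪ pr_C^* θ)`;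
  if `τ ∪ τ = 0` it vanishes, otherwise the moving supplies `ψ` with `τ ∪ ψ ≠ 0` and `α`, `θ` are
  algebraic, so the product is an exterior product of algebraic classes
  (`AlgebraicClassesExteriorProduct`, `TopDegreeClasses`).

Everything is proved; the moving of the prime divisor `D` at its generic point enters
`cup_p12_p23_mem_algebraicClasses_of_common_curve` as an explicit hypothesis (no named fact).

## References

* [VoisinHodgeII2003] C. Voisin, Hodge Theory and Complex Algebraic Geometry II, CUP 2003, §9.2.4
  Prop. 9.20, §9.2.3 Lemma 9.18.
* [Fulton1998] W. Fulton, Intersection Theory, 2nd ed. 1998, §6.3 (excess intersection), §16.1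
  Def. 16.1.1, §19.2.
* [Buskin2019] N. Buskin, Every rational Hodge isometry between two K3 surfaces is algebraic,
  J. reine angew. Math. 755 (2019), Lemma 6.3.
* [HatcherAT2002] A. Hatcher, Algebraic Topology, CUP 2002, §3.2 Thm. 3.16 and Thm. 3.21.
-/

noncomputable section

open CategoryTheory AlgebraicGeometry MonoidalCategory CartesianMonoidalCategory
open Literature.AlgebraicGeometry.Motives
open Literature.AlgebraicTopology.SingularHomology

namespace Literature.AlgebraicGeometry.HodgeTheory

section HodgeTheory

variable {A B C : SchemeOver ℂ}

/-! ### Künneth decompositions of classes supported over a curve of the middle factor -/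

/-- **`γ = pr_A^* α ∪ pr_B^* τ + (B-degree ≥ 3)`**: for surfaces `A`, `B`, a closed `D ⊆ B` all of
whose points have codimension `≥ 1`, a class `τ ∈ H²(B(ℂ))` spanning the classes dying off `D`
(purity), and `γ ∈ H⁴((A ⊗ B)(ℂ))` dying off `pr_B⁻¹ D`: there are `α ∈ H²(A(ℂ))` and `r` in the
span of the cross products `pr_A^* a ∪ pr_B^* c` with `deg c ≥ 3` such that
`γ = pr_A^* α ∪ pr_B^* τ + r` (Künneth with supports; the `B`-components of degree `≤ 1` supported
on `D` vanish by semipurity). [cite: HatcherAT2002, §3.2 Thm. 3.21] [cite: Fulton1998, §19.1–19.2] -/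
theorem exists_cross_add_of_restrictCompl_snd_preimage_eq_zero (hA : IsSmoothProjective 2 A)
    (hB : IsSmoothProjective 2 B) {D : Set B.left} (hDc : IsClosed D)
    (hD1 : ∀ z ∈ D, ((1 : ℕ) : ℕ∞) ≤ Order.coheight z) {τ : complexBetti B (2 * 1)}
    (hτ : LinearMap.ker (complexBetti.restrictCompl B D (2 * 1)).hom ≤ Submodule.span ℂ {τ})
    {γ : complexBetti (A ⊗ B) (2 * 2)}
    (hγ : complexBetti.restrictCompl (A ⊗ B) ((snd A B).left.base ⁻¹' D) (2 * 2) γ = 0) :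
    ∃ (α : complexBetti A (2 * 1)) (r : complexBetti (A ⊗ B) (2 * 2)),
      r ∈ Submodule.span ℂ {v | ∃ (i j : ℕ) (h : i + j = 2 * 2) (a : complexBetti A i)
        (c : complexBetti B j), 3 ≤ j ∧
          v = cupProduct h (complexBetti.map (fst A B) i a) (complexBetti.map (snd A B) j c)} ∧
      γ = cupProduct (show 2 * 1 + 2 * 1 = 2 * 2 from rfl) (complexBetti.map (fst A B) (2 * 1) α)
        (complexBetti.map (snd A B) (2 * 1) τ) + r := by
  -- the linear map `α ↦ pr_A^* α ∪ pr_B^* τ` and the high span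
  set L : complexBetti A (2 * 1) →ₗ[ℂ] complexBetti (A ⊗ B) (2 * 2) :=
    ((cupProduct (show 2 * 1 + 2 * 1 = 2 * 2 from rfl)).flip (complexBetti.map (snd A B) (2 * 1) τ)) ∘ₗ
      (complexBetti.map (fst A B) (2 * 1)).hom with hL
  set H : Submodule ℂ (complexBetti (A ⊗ B) (2 * 2)) := Submodule.span ℂ
    {v | ∃ (i j : ℕ) (h : i + j = 2 * 2) (a : complexBetti A i) (c : complexBetti B j), 3 ≤ j ∧
      v = cupProduct h (complexBetti.map (fst A B) i a) (complexBetti.map (snd A B) j c)} with hH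
  suffices hmem : γ ∈ LinearMap.range L ⊔ H by
    obtain ⟨y, hy, z, hz, hyz⟩ := Submodule.mem_sup.1 hmem
    obtain ⟨α, rfl⟩ := LinearMap.mem_range.1 hy
    exact ⟨α, z, hz, hyz.symm⟩
  refine (Submodule.span_le.2 ?_) (mem_span_cross_of_restrictCompl_snd_eq_zero hA hB hDc hγ)
  rintro _ ⟨i, j, h, a, c, hc, rfl⟩
  rcases le_or_gt 3 j with hj | hj
  · exact Submodule.mem_sup_right (Submodule.subset_span ⟨i, j, h, a, c, hj, rfl⟩)
  rcases le_or_gt 2 j with hj2 | hj2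
  · -- `j = 2`: `c ∈ ker_D ≤ ℂ τ`
    obtain rfl : j = 2 * 1 := by omega
    obtain rfl : i = 2 * 1 := by omega
    obtain ⟨s, rfl⟩ := Submodule.mem_span_singleton.1 (hτ (LinearMap.mem_ker.2 hc))
    refine Submodule.mem_sup_left (LinearMap.mem_range.2 ⟨s • a, ?_⟩)
    simp only [hL, LinearMap.coe_comp, Function.comp_apply, LinearMap.flip_apply, map_smul]
  · -- `j ≤ 1`: `c = 0` by semipurity
    have hinj := injective_restrictCompl_of_le_coheight hB hDc hD1 (i := j) (by omega)
    have hc0 : c = 0 := hinj (by rw [hc, map_zero])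
    rw [hc0, map_zero, map_zero]
    exact Submodule.zero_mem _

/-- **`γ₁ = pr_B^* τ ∪ pr_C^* θ + (B-degree ≥ 3)`** on `B ⊗ C`, for `γ₁ ∈ H⁴((B ⊗ C)(ℂ))` dying off
`pr_B⁻¹ D` (mirror of `exists_cross_add_of_restrictCompl_snd_preimage_eq_zero`).
[cite: HatcherAT2002, §3.2 Thm. 3.21] [cite: Fulton1998, §19.1–19.2] -/
theorem exists_cross_add_of_restrictCompl_fst_preimage_eq_zero (hB : IsSmoothProjective 2 B)
    (hC : IsSmoothProjective 2 C) {D : Set B.left} (hDc : IsClosed D)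
    (hD1 : ∀ z ∈ D, ((1 : ℕ) : ℕ∞) ≤ Order.coheight z) {τ : complexBetti B (2 * 1)}
    (hτ : LinearMap.ker (complexBetti.restrictCompl B D (2 * 1)).hom ≤ Submodule.span ℂ {τ})
    {γ₁ : complexBetti (B ⊗ C) (2 * 2)}
    (hγ₁ : complexBetti.restrictCompl (B ⊗ C) ((fst B C).left.base ⁻¹' D) (2 * 2) γ₁ = 0) :
    ∃ (θ : complexBetti C (2 * 1)) (r : complexBetti (B ⊗ C) (2 * 2)),
      r ∈ Submodule.span ℂ {v | ∃ (i j : ℕ) (h : i + j = 2 * 2) (c : complexBetti B i)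
        (e : complexBetti C j), 3 ≤ i ∧
          v = cupProduct h (complexBetti.map (fst B C) i c) (complexBetti.map (snd B C) j e)} ∧
      γ₁ = cupProduct (show 2 * 1 + 2 * 1 = 2 * 2 from rfl) (complexBetti.map (fst B C) (2 * 1) τ)
        (complexBetti.map (snd B C) (2 * 1) θ) + r := by
  set M : complexBetti C (2 * 1) →ₗ[ℂ] complexBetti (B ⊗ C) (2 * 2) :=
    (cupProduct (show 2 * 1 + 2 * 1 = 2 * 2 from rfl) (complexBetti.map (fst B C) (2 * 1) τ)) ∘ₗ
      (complexBetti.map (snd B C) (2 * 1)).hom with hM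
  set H : Submodule ℂ (complexBetti (B ⊗ C) (2 * 2)) := Submodule.span ℂ
    {v | ∃ (i j : ℕ) (h : i + j = 2 * 2) (c : complexBetti B i) (e : complexBetti C j), 3 ≤ i ∧
      v = cupProduct h (complexBetti.map (fst B C) i c) (complexBetti.map (snd B C) j e)} with hH
  suffices hmem : γ₁ ∈ LinearMap.range M ⊔ H by
    obtain ⟨y, hy, z, hz, hyz⟩ := Submodule.mem_sup.1 hmem
    obtain ⟨θ, rfl⟩ := LinearMap.mem_range.1 hy
    exact ⟨θ, z, hz, hyz.symm⟩
  refine (Submodule.span_le.2 ?_) (mem_span_cross_of_restrictCompl_fst_eq_zero hB hC hDc hγ₁)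
  rintro _ ⟨i, j, h, c, e, hc, rfl⟩
  rcases le_or_gt 3 i with hi | hi
  · exact Submodule.mem_sup_right (Submodule.subset_span ⟨i, j, h, c, e, hi, rfl⟩)
  rcases le_or_gt 2 i with hi2 | hi2
  · obtain rfl : i = 2 * 1 := by omega
    obtain rfl : j = 2 * 1 := by omega
    obtain ⟨s, rfl⟩ := Submodule.mem_span_singleton.1 (hτ (LinearMap.mem_ker.2 hc))
    refine Submodule.mem_sup_left (LinearMap.mem_range.2 ⟨s • e, ?_⟩)
    simp only [hM, LinearMap.coe_comp, Function.comp_apply, map_smul, LinearMap.smul_apply]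
  · have hinj := injective_restrictCompl_of_le_coheight hB hDc hD1 (i := i) (by omega)
    have hc0 : c = 0 := hinj (by rw [hc, map_zero])
    rw [hc0, map_zero, map_zero, LinearMap.zero_apply]
    exact Submodule.zero_mem _

/-! ### The Künneth coefficients are algebraic once `τ` pairs non-trivially with a moved class -/

/-- **The coefficient `α` is algebraic.** For surfaces `A`, `B`, a closed `Γ ⊆ A ⊗ B` off which `γ`
dies, a closed `T ⊆ B` with `Γ ∩ pr_B⁻¹ T` of codimension `≥ 3` and a class `ψ ∈ H²(B(ℂ))` dying
off `T` with `τ ∪ ψ ≠ 0`: if `γ = pr_A^* α ∪ pr_B^* τ + r`, `r` in the span of cross products of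
`B`-degree `≥ 3`, then `α ∈ N¹H²(A(ℂ))`. Proof: `γ ∪ pr_B^* ψ ∈ N³H⁶((A ⊗ B)(ℂ))` (cup product with
supports) equals `pr_A^* α ∪ pr_B^*(τ ∪ ψ)` (`H^{≥5}(B(ℂ)) = 0` kills `r ∪ pr_B^* ψ`), and
`(pr_A)_*` of it is `c • α` with `c ≠ 0` (projection formula, `H⁰(A(ℂ)) = ℂ · 1`,
`GysinProjectionNonvanishing`) and algebraic (push-forwards preserve algebraic classes).
[cite: VoisinHodgeII2003, §9.2.4 Prop. 9.20] [cite: Fulton1998, §19.2 and §6.3] -/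
theorem fst_coeff_mem_algebraicClasses (μ : OrientationFamily) (hA : IsSmoothProjective 2 A)
    (hB : IsSmoothProjective 2 B) {Γ : Set (A ⊗ B).left} (hΓc : IsClosed Γ) {T : Set B.left}
    (hTc : IsClosed T)
    (hcod : ∀ t ∈ Γ ∩ (snd A B).left.base ⁻¹' T, ((3 : ℕ) : ℕ∞) ≤ Order.coheight t)
    {ψ τ : complexBetti B (2 * 1)} (hψ : complexBetti.restrictCompl B T (2 * 1) ψ = 0)
    (hν : cupProduct (show 2 * 1 + 2 * 1 = 2 * 2 from rfl) τ ψ ≠ 0)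
    {γ : complexBetti (A ⊗ B) (2 * 2)} (hγ : complexBetti.restrictCompl (A ⊗ B) Γ (2 * 2) γ = 0)
    {α : complexBetti A (2 * 1)} {r : complexBetti (A ⊗ B) (2 * 2)}
    (hr : r ∈ Submodule.span ℂ {v | ∃ (i j : ℕ) (h : i + j = 2 * 2) (a : complexBetti A i)
      (c : complexBetti B j), 3 ≤ j ∧
        v = cupProduct h (complexBetti.map (fst A B) i a) (complexBetti.map (snd A B) j c)})
    (hdec : γ = cupProduct (show 2 * 1 + 2 * 1 = 2 * 2 from rfl) (complexBetti.map (fst A B) (2 * 1) α)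
      (complexBetti.map (snd A B) (2 * 1) τ) + r) :
    α ∈ algebraicClasses A 1 := by
  have hμ : μ.HasPoincareDuality := OrientationFamily.hasPoincareDuality μ
  have hAB := IsSmoothProjective.tensor_holds hA hB
  -- (i) `γ ∪ pr_B^* ψ` is supported in codimension `3`
  have hsup : cupProduct (show 2 * 2 + 2 * 1 = 2 * 3 from rfl) γ
      (complexBetti.map (snd A B) (2 * 1) ψ) ∈ algebraicClasses (A ⊗ B) 3 :=
    cupProduct_mem_supportedClasses_of_inter hΓc (hTc.preimage (snd A B).left.base.hom.continuous)
      hcod _ hγ (complexBetti.restrictCompl_map_eq_zero (snd A B) hψ)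
  -- (ii) `γ ∪ pr_B^* ψ = pr_A^* α ∪ pr_B^*(τ ∪ ψ)`
  have hvan : ∀ x ∈ Submodule.span ℂ {v | ∃ (i j : ℕ) (h : i + j = 2 * 2) (a : complexBetti A i)
      (c : complexBetti B j), 3 ≤ j ∧
        v = cupProduct h (complexBetti.map (fst A B) i a) (complexBetti.map (snd A B) j c)},
      cupProduct (show 2 * 2 + 2 * 1 = 2 * 3 from rfl) x
        (complexBetti.map (snd A B) (2 * 1) ψ) = 0 := by
    intro x hx
    induction hx using Submodule.span_induction with
    | mem x hx =>
      obtain ⟨i, j, h, a, c, hj, rfl⟩ := hx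
      rw [cup_cross_map_snd h _ (rfl : j + 2 * 1 = j + 2 * 1) (by omega)]
      haveI := subsingleton_complexBetti hB (show 2 * 2 < j + 2 * 1 by omega)
      rw [Subsingleton.elim (cupProduct (rfl : j + 2 * 1 = j + 2 * 1) c ψ) 0, map_zero, map_zero]
    | zero => rw [map_zero, LinearMap.zero_apply]
    | add x y _ _ hx hy => rw [map_add, LinearMap.add_apply, hx, hy, add_zero]
    | smul s x _ hx => rw [map_smul, LinearMap.smul_apply, hx, smul_zero]
  have heq : cupProduct (show 2 * 2 + 2 * 1 = 2 * 3 from rfl) γ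
      (complexBetti.map (snd A B) (2 * 1) ψ) =
      cupProduct (show 2 * 1 + 2 * 2 = 2 * 3 from rfl) (complexBetti.map (fst A B) (2 * 1) α)
        (complexBetti.map (snd A B) (2 * 2) (cupProduct (show 2 * 1 + 2 * 1 = 2 * 2 from rfl) τ ψ)) := by
    rw [hdec, map_add, LinearMap.add_apply, hvan r hr, add_zero,
      cup_cross_map_snd (show 2 * 1 + 2 * 1 = 2 * 2 from rfl) _ (show 2 * 1 + 2 * 1 = 2 * 2 from rfl)]
  -- (iii) push forward along `pr_A`
  have halg := complexGysin_mem_algebraicClasses (gysinMap_restrictCompl_eq_zero_of_field ℂ) μ hμ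
    hAB hA (fst A B) (show 3 + 2 = 1 + (2 + 2) from rfl)
    (show 2 * 3 + 2 * 2 = 2 * 1 + 2 * (2 + 2) from rfl) hsup
  rw [heq, complexGysin_cup hμ hAB hA (fst A B) (show 2 * 1 + 2 * 2 = 2 * 3 from rfl)
    (show 2 * 3 + 2 * 2 = 2 * 1 + 2 * (2 + 2) from rfl)
    (show 2 * 2 + 2 * 2 = 0 + 2 * (2 + 2) from rfl) (Nat.add_zero _)] at halg
  obtain ⟨t, ht⟩ := exists_eq_smul_one μ hA (complexGysin μ hAB hA (fst A B)
    (show 2 * 2 + 2 * 2 = 0 + 2 * (2 + 2) from rfl)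
    (complexBetti.map (snd A B) (2 * 2) (cupProduct (show 2 * 1 + 2 * 1 = 2 * 2 from rfl) τ ψ)))
  have hne := complexGysin_fst_map_snd_ne_zero μ hA hB hν
  have ht0 : t ≠ 0 := by
    rintro rfl
    exact hne (by rw [ht, zero_smul])
  rw [ht, map_smul, cupProduct_one] at halg
  have h := Submodule.smul_mem _ t⁻¹ halg
  rwa [smul_smul, inv_mul_cancel₀ ht0, one_smul] at h

/-- **The coefficient `θ` is algebraic** (mirror of `fst_coeff_mem_algebraicClasses` on `B ⊗ C`,
with `pr_B^* ψ ∪ γ₁ = pr_B^*(ψ ∪ τ) ∪ pr_C^* θ` pushed forward along `pr_C`).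
[cite: VoisinHodgeII2003, §9.2.4 Prop. 9.20] [cite: Fulton1998, §19.2 and §6.3] -/
theorem snd_coeff_mem_algebraicClasses (μ : OrientationFamily) (hB : IsSmoothProjective 2 B)
    (hC : IsSmoothProjective 2 C) {Γ' : Set (B ⊗ C).left} (hΓc : IsClosed Γ') {T : Set B.left}
    (hTc : IsClosed T)
    (hcod : ∀ t ∈ (fst B C).left.base ⁻¹' T ∩ Γ', ((3 : ℕ) : ℕ∞) ≤ Order.coheight t)
    {ψ τ : complexBetti B (2 * 1)} (hψ : complexBetti.restrictCompl B T (2 * 1) ψ = 0)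
    (hν : cupProduct (show 2 * 1 + 2 * 1 = 2 * 2 from rfl) τ ψ ≠ 0)
    {γ₁ : complexBetti (B ⊗ C) (2 * 2)}
    (hγ₁ : complexBetti.restrictCompl (B ⊗ C) Γ' (2 * 2) γ₁ = 0)
    {θ : complexBetti C (2 * 1)} {r : complexBetti (B ⊗ C) (2 * 2)}
    (hr : r ∈ Submodule.span ℂ {v | ∃ (i j : ℕ) (h : i + j = 2 * 2) (c : complexBetti B i)
      (e : complexBetti C j), 3 ≤ i ∧
        v = cupProduct h (complexBetti.map (fst B C) i c) (complexBetti.map (snd B C) j e)})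
    (hdec : γ₁ = cupProduct (show 2 * 1 + 2 * 1 = 2 * 2 from rfl) (complexBetti.map (fst B C) (2 * 1) τ)
      (complexBetti.map (snd B C) (2 * 1) θ) + r) :
    θ ∈ algebraicClasses C 1 := by
  have hμ : μ.HasPoincareDuality := OrientationFamily.hasPoincareDuality μ
  have hBC := IsSmoothProjective.tensor_holds hB hC
  -- (i) `pr_B^* ψ ∪ γ₁` is supported in codimension `3`
  have hsup : cupProduct (show 2 * 1 + 2 * 2 = 2 * 3 from rfl)
      (complexBetti.map (fst B C) (2 * 1) ψ) γ₁ ∈ algebraicClasses (B ⊗ C) 3 :=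
    cupProduct_mem_supportedClasses_of_inter (hTc.preimage (fst B C).left.base.hom.continuous) hΓc
      hcod _ (complexBetti.restrictCompl_map_eq_zero (fst B C) hψ) hγ₁
  -- (ii) `pr_B^* ψ ∪ γ₁ = pr_B^*(ψ ∪ τ) ∪ pr_C^* θ = pr_C^* θ ∪ pr_B^*(ψ ∪ τ)`
  have hvan : ∀ x ∈ Submodule.span ℂ {v | ∃ (i j : ℕ) (h : i + j = 2 * 2) (c : complexBetti B i)
      (e : complexBetti C j), 3 ≤ i ∧
        v = cupProduct h (complexBetti.map (fst B C) i c) (complexBetti.map (snd B C) j e)},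
      cupProduct (show 2 * 1 + 2 * 2 = 2 * 3 from rfl)
        (complexBetti.map (fst B C) (2 * 1) ψ) x = 0 := by
    intro x hx
    induction hx using Submodule.span_induction with
    | mem x hx =>
      obtain ⟨i, j, h, c, e, hi, rfl⟩ := hx
      rw [map_fst_cup_cross h _ (rfl : 2 * 1 + i = 2 * 1 + i) (by omega)]
      haveI := subsingleton_complexBetti hB (show 2 * 2 < 2 * 1 + i by omega)
      rw [Subsingleton.elim (cupProduct (rfl : 2 * 1 + i = 2 * 1 + i) ψ c) 0, map_zero, map_zero,
        LinearMap.zero_apply]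
    | zero => rw [map_zero]
    | add x y _ _ hx hy => rw [map_add, hx, hy, add_zero]
    | smul s x _ hx => rw [map_smul, hx, smul_zero]
  have hψτ : cupProduct (show 2 * 1 + 2 * 1 = 2 * 2 from rfl) ψ τ = cupProduct (show 2 * 1 + 2 * 1 = 2 * 2 from rfl) τ ψ := by
    rw [cupProduct_gradedComm_holds ℂ _ (show 2 * 1 + 2 * 1 = 2 * 2 from rfl) (show 2 * 1 + 2 * 1 = 2 * 2 from rfl) ψ τ]
    norm_num
  have heq : cupProduct (show 2 * 1 + 2 * 2 = 2 * 3 from rfl)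
      (complexBetti.map (fst B C) (2 * 1) ψ) γ₁ =
      cupProduct (show 2 * 1 + 2 * 2 = 2 * 3 from rfl) (complexBetti.map (snd B C) (2 * 1) θ)
        (complexBetti.map (fst B C) (2 * 2) (cupProduct (show 2 * 1 + 2 * 1 = 2 * 2 from rfl) τ ψ)) := by
    rw [hdec, map_add, hvan r hr, add_zero,
      map_fst_cup_cross (show 2 * 1 + 2 * 1 = 2 * 2 from rfl) _ (show 2 * 1 + 2 * 1 = 2 * 2 from rfl)
        (show 2 * 2 + 2 * 1 = 2 * 3 from rfl), hψτ,
      cupProduct_gradedComm_holds ℂ _ (show 2 * 2 + 2 * 1 = 2 * 3 from rfl)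
        (show 2 * 1 + 2 * 2 = 2 * 3 from rfl)]
    norm_num
  -- (iii) push forward along `pr_C`
  have halg := complexGysin_mem_algebraicClasses (gysinMap_restrictCompl_eq_zero_of_field ℂ) μ hμ
    hBC hC (snd B C) (show 3 + 2 = 1 + (2 + 2) from rfl)
    (show 2 * 3 + 2 * 2 = 2 * 1 + 2 * (2 + 2) from rfl) hsup
  rw [heq, complexGysin_cup hμ hBC hC (snd B C) (show 2 * 1 + 2 * 2 = 2 * 3 from rfl)
    (show 2 * 3 + 2 * 2 = 2 * 1 + 2 * (2 + 2) from rfl)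
    (show 2 * 2 + 2 * 2 = 0 + 2 * (2 + 2) from rfl) (Nat.add_zero _)] at halg
  obtain ⟨t, ht⟩ := exists_eq_smul_one μ hC (complexGysin μ hBC hC (snd B C)
    (show 2 * 2 + 2 * 2 = 0 + 2 * (2 + 2) from rfl)
    (complexBetti.map (fst B C) (2 * 2) (cupProduct (show 2 * 1 + 2 * 1 = 2 * 2 from rfl) τ ψ)))
  have hne := complexGysin_snd_map_fst_ne_zero μ hB hC hν
  have ht0 : t ≠ 0 := by
    rintro rfl
    exact hne (by rw [ht, zero_smul])
  rw [ht, map_smul, cupProduct_one] at halg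
  have h := Submodule.smul_mem _ t⁻¹ halg
  rwa [smul_smul, inv_mul_cancel₀ ht0, one_smul] at h

end HodgeTheory

end Literature.AlgebraicGeometry.HodgeTheory

end
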